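import Summits.HodgeConjecture.HodgeConjecture.Theorems.MarkmanPartnerTransportPicardThreeK3SquaresKugaSatakeSectorU2ab
import Literature.NumberTheory.QuadraticForms.RepresentationCodimThree
import Literature.NumberTheory.QuadraticForms.WittExtensionHolds
import Mathlib.LinearAlgebra.QuadraticForm.Signature

/-!
# Route MarkmanPartnerTransport · crux `PicardThreeK3Squares` (stmt-HodgeConjecture-19652) —
# lattice lemma: EVERY non-degenerate subspace of `Λ_{K3} ⊗ ℚ` of dimension `≤ 11` can be moved, by a
# rational isometry of `Λ_ℚ`, into the orthogonal complement of the anti-diagonal `E₈(−2)`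

Pure rational lattice theory on the tree's model `Λ_ℚ = ℚ^{K3Index}` of `Λ_{K3} ⊗ ℚ = (E₈(−1)^{⊕2} ⊕ U^{⊕3}) ⊗ ℚ`
(`k3FormRat`). Let `K ⊂ Λ_ℚ` be the ANTI-DIAGONAL copy `{(x, −x; 0)}` of `E₈(−2) ⊗ ℚ` — the rational span
of the anti-invariant lattice of the model Nikulin involution (van Geemen–Sarti §1.3; the tree's
`nikulinAntiInvariant`, `K3NikulinInvolutionInvariantLattice.lean`) — and `M = K^⊥ ≅ (U^{⊕3} ⊕ E₈(−2)) ⊗ ℚ`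
its orthogonal complement (dimension `14`, indices `(3, 11)`). THEOREM
(`exists_isometryEquiv_orthogonal_antidiagE8`): for every subspace `T ⊂ Λ_ℚ` on which the form is
non-degenerate and with `dim T ≤ 11`, there is a rational isometry `σ ∈ O(Λ_ℚ)` with `σ(T) ⊥ K`, i.e.
`σ(T) ⊂ M`. Proof: `T` has positive index `≤ 3` (it sits in `Λ_ℚ`, whose positive index is `≤ 3`:
the form is negative definite on the `19`-dimensional subspace of vectors anti-diagonal on the three
hyperbolic planes, `KugaSatakeSector.k3FormRat_self_neg_of_antidiag`) and negative index `≤ dim T ≤ 11`,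
while `M` has dimension `14 ≥ dim T + 3`, positive index `≥ 3` (the span of `e₁ + f₁, e₂ + f₂, e₃ + f₃`)
and negative index `= 14 − (positive index) ≥ 11`; so Kitaoka's codimension-`3` representation theorem
(`exists_isometry_of_sigPos_le_of_sigNeg_le_of_finrank_add_three_le`, PROVED in the tree: O'Meara 63:21 +
66:3, Kitaoka Cor. 4.1.4) embeds `T` isometrically into `M`, and Witt's extension theorem
(`WittExtension_holds`, Serre IV Thm. 3) extends the embedding to an isometry of `Λ_ℚ`.

This is the lattice half of «every projective K3 surface of Picard rank `≥ 11` is isogenous to a K3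
surface with a Nikulin involution» (Varesco 2023 Prop. 2.5: "`X` is Hodge isometric to a K3 surface
admitting a Nikulin involution iff `T(X) ↪ U³_ℚ ⊕ E₈(−2)_ℚ`" — the embedding being AUTOMATIC when
`rk T(X) = 22 − ρ(X) ≤ 11`, a remark not made in print), used downstream for the crux's residue at
`ρ ∈ {12, 14, 16}` with real multiplication by `ℚ(√2)`.

* `sigPos_k3FormRat_le_three`, `sigPos_restrict_le_three` — positive index of `Λ_ℚ` and of any
  subspace is `≤ 3`.
* `exists_isometryEquiv_orthogonal_antidiagE8` — the theorem.

No definition, no named fact, no sorry. Prover seat hodge-nonav-19652-p1 (gen 3),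
`--supports stmt-HodgeConjecture-19652`.

References: Y. Kitaoka, *Arithmetic of Quadratic Forms*, Cor. 4.1.4; J.-P. Serre, *A Course in
Arithmetic*, IV Thm. 3 (Witt); M. Varesco, Math. Z. 305 (2023), §2 Prop. 2.5; B. van Geemen, A. Sarti,
Math. Z. 255 (2007), §1.3; D. Huybrechts, *Lectures on K3 Surfaces*, Ch. 14 §0.3 (vi).
-/

set_option linter.dupNamespace false

noncomputable section

namespace Summit.HodgeConjecture.HodgeConjecture.Theorems.MarkmanPartnerTransport.NikulinIsogeny

open Module QuadraticMap
open Literature.AlgebraicGeometry.Surfaces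
open Literature.NumberTheory.QuadraticForms
open Summit.HodgeConjecture.HodgeConjecture.Theorems.MarkmanPartnerTransport.KugaSatakeSector

/-! ### The positive index of `Λ_ℚ` is at most `3` -/

/-- **`b⁺(Λ_ℚ) ≤ 3`**: the rational K3 form is non-positive on the `19`-dimensional subspace of vectors
anti-diagonal on the three hyperbolic planes (`k3FormRat_self_neg_of_antidiag`), so a positive definite
subspace has dimension `≤ 22 − 19` (`QuadraticForm.sigPos_add_finrank_le_of_nonpos`).
[cite: Huybrechts2016K3, Ch. 14 §0.3 (vi) (signature `(3, 19)`)] -/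
theorem sigPos_k3FormRat_le_three :
    sigPos (k3FormRat.toQuadraticMap : QuadraticForm ℚ (K3Index → ℚ)) ≤ 3 := by
  classical
  -- the antidiagonal subspace `A = ker π`, of dimension `≥ 19`
  let π : (K3Index → ℚ) →ₗ[ℚ] (Fin 3 → ℚ) :=
    { toFun := fun v => ![v (Sum.inr (Sum.inl 0)) + v (Sum.inr (Sum.inl 1)),
        v (Sum.inr (Sum.inr (Sum.inl 0))) + v (Sum.inr (Sum.inr (Sum.inl 1))),
        v (Sum.inr (Sum.inr (Sum.inr 0))) + v (Sum.inr (Sum.inr (Sum.inr 1)))]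
      map_add' := fun v w => by
        funext k
        fin_cases k <;> simp <;> ring
      map_smul' := fun r v => by
        funext k
        fin_cases k <;> simp <;> ring }
  have hAmem : ∀ v ∈ LinearMap.ker π, v (Sum.inr (Sum.inl 1)) = -v (Sum.inr (Sum.inl 0)) ∧
      v (Sum.inr (Sum.inr (Sum.inl 1))) = -v (Sum.inr (Sum.inr (Sum.inl 0))) ∧
      v (Sum.inr (Sum.inr (Sum.inr 1))) = -v (Sum.inr (Sum.inr (Sum.inr 0))) := fun v hv => by
    have h := LinearMap.mem_ker.1 hv
    have h0 := congrFun h 0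
    have h1 := congrFun h 1
    have h2 := congrFun h 2
    simp [π] at h0 h1 h2
    exact ⟨by linarith, by linarith, by linarith⟩
  have hAnonpos : ∀ v ∈ LinearMap.ker π,
      (k3FormRat.toQuadraticMap : QuadraticForm ℚ (K3Index → ℚ)) v ≤ 0 := by
    intro v hv
    rw [LinearMap.BilinMap.toQuadraticMap_apply]
    by_cases hv0 : v = 0
    · subst hv0
      simp
    · exact (k3FormRat_self_neg_of_antidiag (hAmem v hv).1 (hAmem v hv).2.1 (hAmem v hv).2.2 hv0).le
  have hA : 19 ≤ finrank ℚ (LinearMap.ker π) := by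
    have h := LinearMap.finrank_range_add_finrank_ker π
    have hr : finrank ℚ (LinearMap.range π) ≤ 3 := by
      calc finrank ℚ (LinearMap.range π) ≤ finrank ℚ (Fin 3 → ℚ) := Submodule.finrank_le _
        _ = 3 := by rw [finrank_fintype_fun_eq_card]; rfl
    rw [finrank_k3Rat] at h
    omega
  have h := QuadraticForm.sigPos_add_finrank_le_of_nonpos
    (Q := (k3FormRat.toQuadraticMap : QuadraticForm ℚ (K3Index → ℚ))) hAnonpos
  rw [finrank_k3Rat] at h
  omega

/-- **The positive index of the K3 form restricted to ANY subspace `W ⊂ Λ_ℚ` is `≤ 3`** (a positive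
definite subspace of `W` is one of `Λ_ℚ`). [cite: Huybrechts2016K3, Ch. 14 §0.3 (vi)] -/
theorem sigPos_restrict_le_three (W : Submodule ℚ (K3Index → ℚ)) :
    sigPos ((k3FormRat.toQuadraticMap : QuadraticForm ℚ (K3Index → ℚ)).restrict W) ≤ 3 := by
  set QΛ : QuadraticForm ℚ (K3Index → ℚ) := k3FormRat.toQuadraticMap with hQΛ
  obtain ⟨V, hVd, hVpos⟩ := exists_finrank_eq_sigPos_and_posDef (QΛ.restrict W)
  have hpos' : (QΛ.restrict (V.map W.subtype)).PosDef := by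
    rintro ⟨y, hy⟩ hy0
    obtain ⟨v, hvV, rfl⟩ := Submodule.mem_map.1 hy
    have hv0 : (⟨v, hvV⟩ : V) ≠ 0 := by
      intro h
      apply hy0
      have h' : v = 0 := congrArg Subtype.val h
      simp [h']
    exact hVpos ⟨v, hvV⟩ hv0
  have h1 := le_sigPos_of_posDef QΛ hpos'
  rw [Submodule.finrank_map_subtype_eq, hVd] at h1
  exact h1.trans sigPos_k3FormRat_le_three

/-! ### The rational isometry moving a subspace of dimension `≤ 11` into `(E₈(−2)_{antidiag})^⊥` -/

/-- **Lattice lemma.** Let `T ⊂ Λ_ℚ = Λ_{K3} ⊗ ℚ` be a subspace on which the K3 form is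
non-degenerate (`T ∩ T^⊥ = 0`) with `dim T ≤ 11`. Then there is an isometry `σ` of `(Λ_ℚ, k3FormRat)`
such that `σ(T)` is orthogonal to the anti-diagonal `E₈(−2) ⊗ ℚ = {(x, −x; 0) : x ∈ ℚ⁸}` (the rational
span of the anti-invariant lattice of the model Nikulin involution). Proof: Kitaoka's codimension-`3`
representation theorem embeds `T` (indices `(≤ 3, ≤ 11)`) into `M = (E₈(−2)_{antidiag})^⊥`
(dimension `14`, indices `(≥ 3, ≥ 11)`), and Witt's theorem extends the embedding to `O(Λ_ℚ)`.
[cite: Kitaoka1993, Ch. 4 Cor. 4.1.4] [cite: Serre1973, Ch. IV §1.5 Thm. 3]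
[cite: Varesco2023, §2 Prop. 2.5] [cite: VanGeemenSarti2007, §1.3] -/
theorem exists_isometryEquiv_orthogonal_antidiagE8 (T : Submodule ℚ (K3Index → ℚ))
    (hT : ∀ t ∈ T, (∀ t' ∈ T, k3FormRat t t' = 0) → t = 0) (hdim : finrank ℚ T ≤ 11) :
    ∃ σ : k3FormRat.IsometryEquiv k3FormRat,
      ∀ t ∈ T, ∀ x : Fin 8 → ℚ,
        k3FormRat (Sum.elim (Sum.elim x (-x)) 0 : K3Index → ℚ) (σ t) = 0 := by
  classical
  set B : LinearMap.BilinForm ℚ (K3Index → ℚ) := k3FormRat with hBdef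
  set QΛ : QuadraticForm ℚ (K3Index → ℚ) := B.toQuadraticMap with hQΛ
  have hQΛapp : ∀ v, QΛ v = B v v := fun v => rfl
  have hBsymm : ∀ v w, B v w = B w v := fun v w => k3FormRat_isSymm.eq v w
  -- the anti-diagonal `E₈(−2)_ℚ`: `K = {(x, −x; 0)}`
  let aK : (Fin 8 → ℚ) →ₗ[ℚ] (K3Index → ℚ) :=
    { toFun := fun x => Sum.elim (Sum.elim x (-x)) (0 : Fin 2 ⊕ (Fin 2 ⊕ Fin 2) → ℚ)
      map_add' := fun x y => by
        funext i
        rcases i with (a | a) | b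
        · rfl
        · simp only [Sum.elim_inl, Sum.elim_inr, Pi.add_apply, Pi.neg_apply, neg_add]
        · simp
      map_smul' := fun c x => by
        funext i
        rcases i with (a | a) | b
        · rfl
        · simp only [Sum.elim_inl, Sum.elim_inr, Pi.smul_apply, Pi.neg_apply, smul_eq_mul,
            RingHom.id_apply, mul_neg]
        · simp }
  have haK : ∀ x, aK x = Sum.elim (Sum.elim x (-x)) (0 : Fin 2 ⊕ (Fin 2 ⊕ Fin 2) → ℚ) := fun x => rfl
  set K : Submodule ℚ (K3Index → ℚ) := LinearMap.range aK with hKdef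
  have hKinj : Function.Injective aK := by
    intro x y h
    funext a
    have := congrFun h (Sum.inl (Sum.inl a))
    simpa [haK] using this
  have hKdim : finrank ℚ K = 8 := by
    rw [hKdef, LinearMap.finrank_range_of_inj hKinj, finrank_fintype_fun_eq_card, Fintype.card_fin]
  -- `K` is negative definite (its vectors vanish on the hyperbolic planes)
  have hKinr : ∀ v ∈ K, ∀ b : Fin 2 ⊕ (Fin 2 ⊕ Fin 2), v (Sum.inr b) = 0 := by
    rintro v ⟨x, rfl⟩ b
    simp [haK]
  have hKneg : ∀ v ∈ K, v ≠ 0 → B v v < 0 := fun v hv hv0 =>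
    k3FormRat_self_neg_of_antidiag (by rw [hKinr v hv, hKinr v hv, neg_zero])
      (by rw [hKinr v hv, hKinr v hv, neg_zero]) (by rw [hKinr v hv, hKinr v hv, neg_zero]) hv0
  -- `M = K^⊥`, of dimension `14`, non-degenerate
  set M : Submodule ℚ (K3Index → ℚ) := B.orthogonal K with hMdef
  have hMdim : finrank ℚ M = 14 := by
    rw [hMdef, LinearMap.BilinForm.finrank_orthogonal k3FormRat_nondegenerate, finrank_k3Rat, hKdim]
  have hMK : ∀ m ∈ M, ∀ k ∈ K, B k m = 0 := fun m hm k hk =>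
    (LinearMap.BilinForm.mem_orthogonal_iff.1 hm) k hk
  have hMnd : ∀ m ∈ M, (∀ m' ∈ M, B m m' = 0) → m = 0 := by
    intro m hm hperp
    -- `m ∈ M^⊥ = K`
    have hmK : m ∈ K := by
      have h : m ∈ B.orthogonal M := by
        rw [LinearMap.BilinForm.mem_orthogonal_iff]
        intro m' hm'
        change B m' m = 0
        rw [hBsymm]
        exact hperp m' hm'
      rwa [hMdef, LinearMap.BilinForm.orthogonal_orthogonal k3FormRat_nondegenerate
        k3FormRat_isSymm.isRefl] at h
    by_contra hm0
    have h1 := hKneg m hmK hm0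
    have h2 : B m m = 0 := by rw [hMK m hm m hmK]
    rw [h2] at h1
    exact lt_irrefl _ h1
  -- non-degeneracy ⟹ `associated` separating, for `T` and for `M`
  have hsep : ∀ W : Submodule ℚ (K3Index → ℚ), (∀ w ∈ W, (∀ w' ∈ W, B w w' = 0) → w = 0) →
      (QuadraticMap.associated (R := ℚ) (QΛ.restrict W)).SeparatingLeft := by
    intro W hW
    have hQW : QΛ.restrict W = (B.restrict W).toQuadraticMap := QuadraticMap.ext fun w => rfl
    have hassoc : QuadraticMap.associated (R := ℚ) (QΛ.restrict W) = B.restrict W := by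
      rw [hQW]
      exact QuadraticMap.associated_left_inverse ℚ (fun x y => hBsymm x y)
    intro w hw
    rw [hassoc] at hw
    exact Subtype.ext (hW w w.2 fun w' hw' => hw ⟨w', hw'⟩)
  have hsepT := hsep T hT
  have hsepM := hsep M hMnd
  -- `b⁺(M) ≥ 3`: the span of `e₁ + f₁, e₂ + f₂, e₃ + f₃`
  let wP : (Fin 3 → ℚ) →ₗ[ℚ] (K3Index → ℚ) :=
    { toFun := fun c => Sum.elim (0 : Fin 8 ⊕ Fin 8 → ℚ) (Sum.elim (fun _ => c 0) (Sum.elim (fun _ => c 1) (fun _ => c 2)))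
      map_add' := fun c d => by
        funext i
        rcases i with a | (b | (b | b)) <;> simp
      map_smul' := fun r c => by
        funext i
        rcases i with a | (b | (b | b)) <;> simp }
  have hwP : ∀ c, wP c =
      Sum.elim (0 : Fin 8 ⊕ Fin 8 → ℚ) (Sum.elim (fun _ => c 0) (Sum.elim (fun _ => c 1) (fun _ => c 2))) :=
    fun c => rfl
  have hwPsq : ∀ c, B (wP c) (wP c) = 2 * (c 0 ^ 2 + c 1 ^ 2 + c 2 ^ 2) := by
    intro c
    rw [hBdef, k3FormRat_apply, hwP]
    simp [Fintype.sum_sum_type, Fin.sum_univ_two, k3Gram, hyperbolicPlaneGram]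
    ring
  have hwPK : ∀ c x, B (aK x) (wP c) = 0 := by
    intro c x
    rw [hBdef, k3FormRat_apply, hwP, haK]
    simp [Fintype.sum_sum_type, k3Gram]
  have hwPM : ∀ c, wP c ∈ M := by
    intro c
    rw [hMdef, LinearMap.BilinForm.mem_orthogonal_iff]
    rintro k ⟨x, rfl⟩
    exact hwPK c x
  have hwPinj : Function.Injective wP := by
    intro c d h
    funext k
    fin_cases k
    · simpa [hwP] using congrFun h (Sum.inr (Sum.inl 0))
    · simpa [hwP] using congrFun h (Sum.inr (Sum.inr (Sum.inl 0)))
    · simpa [hwP] using congrFun h (Sum.inr (Sum.inr (Sum.inr 0)))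
  have hPle : LinearMap.range wP ≤ M := by
    rintro v ⟨c, rfl⟩
    exact hwPM c
  have hposM : 3 ≤ sigPos (QΛ.restrict M) := by
    let P : Submodule ℚ M := (LinearMap.range wP).comap M.subtype
    have hPd : finrank ℚ P = 3 := by
      rw [(Submodule.comapSubtypeEquivOfLe hPle).finrank_eq, LinearMap.finrank_range_of_inj hwPinj,
        finrank_fintype_fun_eq_card, Fintype.card_fin]
    have hPpos : ((QΛ.restrict M).restrict P).PosDef := by
      rintro ⟨⟨y, hyM⟩, hyP⟩ hy0
      obtain ⟨c, hc⟩ : y ∈ LinearMap.range wP := hyP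
      rw [restrict_apply, restrict_apply, hQΛapp]
      change 0 < B y y
      rw [← hc, hwPsq]
      have hc0 : c ≠ 0 := by
        rintro rfl
        apply hy0
        apply Subtype.ext
        apply Subtype.ext
        change y = 0
        rw [← hc, map_zero]
      have hsum : 0 < c 0 ^ 2 + c 1 ^ 2 + c 2 ^ 2 := by
        by_contra hle
        apply hc0
        have h0 : c 0 ^ 2 = 0 := by nlinarith [sq_nonneg (c 0), sq_nonneg (c 1), sq_nonneg (c 2)]
        have h1 : c 1 ^ 2 = 0 := by nlinarith [sq_nonneg (c 0), sq_nonneg (c 1), sq_nonneg (c 2)]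
        have h2 : c 2 ^ 2 = 0 := by nlinarith [sq_nonneg (c 0), sq_nonneg (c 1), sq_nonneg (c 2)]
        rw [pow_eq_zero_iff two_ne_zero] at h0 h1 h2
        funext k
        fin_cases k
        · exact h0
        · exact h1
        · exact h2
      linarith
    have h := le_sigPos_of_posDef (QΛ.restrict M) hPpos
    rwa [hPd] at h
  -- `b⁻(M) ≥ 11`: `b⁺(M) + b⁻(M) = 14` and `b⁺(M) ≤ 3`
  have hnegM : 11 ≤ sigNeg (QΛ.restrict M) := by
    have h := QuadraticForm.sigPos_add_sigNeg_add_radical (Q := QΛ.restrict M)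
    have hrad : finrank ℚ (QΛ.restrict M).radical = 0 := by
      rw [QuadraticMap.radical_eq_ker_associated, (LinearMap.separatingLeft_iff_ker_eq_bot.1 hsepM),
        finrank_bot]
    have h3 := sigPos_restrict_le_three M
    rw [hrad, add_zero, hMdim] at h
    change sigPos (QΛ.restrict M) ≤ 3 at h3
    omega
  -- Kitaoka: `T ↪ M`
  have hposT : sigPos (QΛ.restrict T) ≤ sigPos (QΛ.restrict M) :=
    (sigPos_restrict_le_three T).trans hposM
  have hnegT : sigNeg (QΛ.restrict T) ≤ sigNeg (QΛ.restrict M) := by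
    have h : sigNeg (QΛ.restrict T) ≤ finrank ℚ T := by
      rw [← sigPos_neg]
      exact sigPos_le_finrank _
    omega
  obtain ⟨f, hf⟩ := exists_isometry_of_sigPos_le_of_sigNeg_le_of_finrank_add_three_le
    (QΛ.restrict T) (QΛ.restrict M) hsepT hsepM (by omega) hposT hnegT
  -- the bilinear isometry `s = (M ⊂ Λ_ℚ) ∘ f : T → Λ_ℚ` (polarisation)
  have hfB : ∀ t t' : T, B ((f t : M) : K3Index → ℚ) ((f t' : M) : K3Index → ℚ) = B t t' := by
    intro t t'
    have h1 : ∀ u : T, B ((f u : M) : K3Index → ℚ) ((f u : M) : K3Index → ℚ) = B u u := fun u => by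
      have h := f.map_app u
      rw [restrict_apply, restrict_apply, hQΛapp, hQΛapp] at h
      exact h
    have hadd := h1 (t + t')
    rw [map_add, Submodule.coe_add, Submodule.coe_add] at hadd
    simp only [map_add, LinearMap.add_apply] at hadd
    have e1 := hBsymm ((f t' : M) : K3Index → ℚ) ((f t : M) : K3Index → ℚ)
    have e2 := hBsymm (t' : K3Index → ℚ) (t : K3Index → ℚ)
    linarith [h1 t, h1 t', e1, e2]
  let s : (B.restrict T).Isometry B :=
    { toLinearMap := M.subtype ∘ₗ f.toLinearMap
      map_app' := fun t t' => by
        rw [LinearMap.BilinForm.restrict_apply]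
        exact hfB t t' }
  have hsapp : ∀ t : T, s t = ((f t : M) : K3Index → ℚ) := fun t => rfl
  have hsinj : Function.Injective s := by
    intro t t' h
    rw [hsapp, hsapp] at h
    exact hf (Subtype.ext h)
  -- Witt: extend `s` to an isometry of `Λ_ℚ`
  obtain ⟨σ, hσ⟩ := WittExtension_holds ℚ two_ne_zero (K3Index → ℚ) (K3Index → ℚ) B B
    k3FormRat_isSymm k3FormRat_isSymm k3FormRat_nondegenerate k3FormRat_nondegenerate
    (LinearMap.BilinForm.Equivalent.refl B) T s hsinj
  refine ⟨σ, fun t ht x => ?_⟩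
  have hmem : σ t ∈ M := by
    have h := hσ ⟨t, ht⟩
    change σ t = s ⟨t, ht⟩ at h
    rw [h, hsapp]
    exact (f ⟨t, ht⟩).2
  exact hMK _ hmem _ ⟨x, rfl⟩

end Summit.HodgeConjecture.HodgeConjecture.Theorems.MarkmanPartnerTransport.NikulinIsogeny

end
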